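import Literature.NumberTheory.IwasawaTheory.ClassicalMuVanishesBoundedRankAlgebra
import Literature.NumberTheory.IwasawaTheory.FukudaGrowthAlgebra
import Literature.NumberTheory.NumberFields.ClassGroupNormGalois
import HarnessLib

/-!
# The norm element of a cyclic `p`-extension kills a `p²`-torsion class with invariant `p`-th power
# (Washington §13.3: `ν_n ≡ T^{p^n − 1} (mod p)`; the algebra behind Ferrero's dyadic class)

Topic `NumberTheory/IwasawaTheory`; namespaces `Literature.NumberTheory.IwasawaTheory.FukudaNakayama` (§1, abstract
algebra) and `Literature.NumberTheory.IwasawaTheory` (§2, ideal classes).  Theorem-only file (no definition, no named fact,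
no `sorry`), unconditional.

## The statement

Let `L/F` be a cyclic extension of number fields of degree `p^k`, `k ≥ 2`, `σ` a generator, and suppose the `p`-rank `r` of
`Cl(L)` (`#Cl(L)[p] = p^r`) satisfies `2r ≤ p^k − 1`.  If `x ∈ Cl(L)` has `x^{p²} = 1` and `σ(x^p) = x^p`, then
**`i_{L/F}(N_{L/F} x) = ∏_{τ ∈ Gal(L/F)} τx = 1`** (`classGroupExtend_classGroupNorm_eq_one_of_pow_sq_eq_one`).

Proof (§1, on the additive group `M = Cl(L)` with `φ =` the action of `σ`): in `ℤ[X]`,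
`Σ_{i<p^k} X^i = (X − 1)^{p^k−1} + p·R(X)` with `R(1) = p^{k−1}` (tree `exists_geom_sum_eq_X_sub_one_pow_add`); since `p·x` is
`φ`-fixed, `p·R(φ)x = R(φ)(p x) = R(1)·p x = p^{k−2}·p² x = 0`, so `ν_k x = (φ − 1)^{p^k−1} x`
(`geom_sum_apply_eq_sub_one_pow_apply`).  On `M[p]` the operator `φ − 1` is nilpotent (`(φ−1)^{p^k} = 0` there) hence vanishes in
`r` steps (tree `pow_apply_eq_zero_of_card_le`); applied to `p x ∈ M[p]` and then to `(φ−1)^r x ∈ M[p]` this gives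
`(φ − 1)^{2r} x = 0`, so `ν_k x = 0` (`geom_sum_apply_eq_zero_of_card_torsion_eq`).  §2 translates to ideal classes with the
tree's `i(N c) = ∏_τ τ c` (`classGroupExtend_classGroupNorm_eq_prod`).

This is the piece of algebra by which the class `[𝔓_n]` of the dyadic prime in the cyclotomic `ℤ₂`-tower of `ℚ(√−d)`,
`d ≡ 1 (mod 4)`, is shown not to be a square for `n ≫ 0` (Ferrero 1980, §3; file `ImaginaryQuadraticTwoTowerDyadicClassNotSquare`).

## References

* L. C. Washington, *Introduction to Cyclotomic Fields*, 2nd ed., GTM 83, Springer 1997, §13.3 (Lemma 13.15–13.16, Prop. 13.22). [Washington1997]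
* B. Ferrero, *The cyclotomic ℤ₂-extension of imaginary quadratic fields*, Amer. J. Math. 102 (1980) 447–459, §3. [Ferrero1980AJM]
* J. Neukirch, *Algebraic Number Theory*, Springer 1999, Ch. III §1 Prop. (1.6) (iv). [NeukirchANT1999]
-/

noncomputable section

open Polynomial Finset

namespace Literature.NumberTheory.IwasawaTheory

namespace FukudaNakayama

variable {M : Type*} [AddCommGroup M]

/-- A polynomial in `φ` acts on a `φ`-fixed vector `v` as the scalar `R(1)` (auxiliary). [folklore] -/
private theorem aeval_apply_of_apply_eq_self (φ : Module.End ℤ M) (R : ℤ[X]) {v : M} (hv : φ v = v) :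
    aeval φ R v = (R.eval 1) • v := by
  induction R using Polynomial.induction_on' with
  | add q r hq hr => rw [map_add, LinearMap.add_apply, hq, hr, eval_add, add_smul]
  | monomial n a =>
    rw [← C_mul_X_pow_eq_monomial, map_mul, map_pow, aeval_C, aeval_X, Module.End.mul_apply, algebraMap_int_eq,
      eq_intCast, Module.End.intCast_apply, eval_mul, eval_C, eval_pow, eval_X, one_pow, mul_one]
    congr 1
    induction n with
    | zero => rw [pow_zero, Module.End.one_apply]
    | succ n ih => rw [pow_succ, Module.End.mul_apply, hv, ih]

/-- **`ν_k x = (φ − 1)^{p^k − 1} x` when `p·x` is `φ`-fixed and `p²·x = 0` (`k ≥ 2`)**: `ν_k = Σ_{i<p^k} φ^i = (φ−1)^{p^k−1} + p·R(φ)`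
with `R(1) = p^{k−1}`, and `p·R(φ)x = R(φ)(p x) = R(1)·(p x) = p^{k−2}·(p² x) = 0`.
[cite: Washington1997, §13.3 (proof of Prop. 13.22: `ν_n ≡ T^{p^n−1} mod p`)] -/
theorem geom_sum_apply_eq_sub_one_pow_apply (p k : ℕ) [hp : Fact p.Prime] (hk : 2 ≤ k) (φ : Module.End ℤ M) (x : M)
    (hfix : φ ((p : ℤ) • x) = (p : ℤ) • x) (hx : (p : ℤ) • ((p : ℤ) • x) = 0) :
    (∑ i ∈ range (p ^ k), φ ^ i) x = ((φ - 1) ^ (p ^ k - 1)) x := by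
  obtain ⟨R, hR⟩ := MuZeroRank.exists_geom_sum_eq_X_sub_one_pow_add p k
  have hp0 : (p : ℤ) ≠ 0 := by exact_mod_cast hp.out.ne_zero
  have hpk : p ^ k - 1 ≠ 0 := by
    have : p ^ 2 ≤ p ^ k := Nat.pow_le_pow_right hp.out.pos hk
    have : 4 ≤ p ^ 2 := by
      have h2 := hp.out.two_le
      calc 4 = 2 ^ 2 := by norm_num
        _ ≤ p ^ 2 := Nat.pow_le_pow_left h2 2
    omega
  -- `R(1) = p^{k-1}`
  have hR1 : R.eval 1 = (p : ℤ) ^ (k - 1) := by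
    have h := congrArg (Polynomial.eval 1) hR
    rw [eval_finsetSum, eval_add, eval_mul, eval_C, eval_pow, eval_sub, eval_X, eval_one, sub_self,
      zero_pow hpk, zero_add] at h
    simp only [eval_pow, eval_X, one_pow, sum_const, card_range, Nat.smul_one_eq_cast, Nat.cast_pow] at h
    have h' : (p : ℤ) * (p : ℤ) ^ (k - 1) = (p : ℤ) * R.eval 1 := by
      rw [← pow_succ', Nat.sub_add_cancel (by omega : 1 ≤ k)]
      exact h
    exact (mul_left_cancel₀ hp0 h').symm
  have h2 := congrArg (aeval φ) hR
  rw [map_sum, map_add, map_pow, map_sub, aeval_X, map_one, map_mul, aeval_C, algebraMap_int_eq, eq_intCast] at h2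
  simp only [map_pow, aeval_X] at h2
  rw [h2, LinearMap.add_apply, Module.End.mul_apply, Module.End.intCast_apply, ← map_smul,
    aeval_apply_of_apply_eq_self φ R hfix, hR1]
  obtain ⟨j, hj⟩ : ∃ j, k - 1 = j + 1 := ⟨k - 2, by omega⟩
  rw [hj, pow_succ, mul_smul, hx, smul_zero, add_zero]

/-- **`φ^{p^k} = 1` and `p·w = 0` ⟹ `(φ − 1)^{p^k} w = 0`** (`(X+1)^{p^k} = X^{p^k} + 1 + p·R(X)` at `X = φ − 1`).
[cite: Washington1997, §13.3 Lemma 13.16 (proof)] -/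
theorem sub_one_pow_prime_pow_apply_eq_zero_of_smul_eq_zero (p k : ℕ) [Fact p.Prime] (φ : Module.End ℤ M)
    (hφ : φ ^ (p ^ k) = 1) {w : M} (hw : (p : ℤ) • w = 0) : ((φ - 1) ^ (p ^ k)) w = 0 := by
  obtain ⟨R, hR⟩ := FukudaNakayama.exists_X_add_one_pow_prime_pow_eq p k
  have h := congrArg (aeval (φ - 1)) hR
  rw [map_pow, map_add, aeval_X, map_one, sub_add_cancel, hφ, map_add, map_add, map_pow, aeval_X, map_one, map_mul,
    aeval_C, algebraMap_int_eq, eq_intCast] at h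
  have h1 := congrArg (fun f : Module.End ℤ M => f w) h
  simp only [Module.End.one_apply, LinearMap.add_apply, Module.End.mul_apply, Module.End.intCast_apply] at h1
  rw [← map_smul, hw, map_zero, add_zero] at h1
  have h2 : ((φ - 1) ^ (p ^ k)) w + w = 0 + w := by rw [zero_add]; exact h1.symm
  exact add_right_cancel h2

/-- **A unipotent endomorphism vanishes on `M[p]` in `r` steps when `#M[p] = p^r`**: `M` finite, `φ^{p^k} = 1`,
`#{m : p·m = 0} = p^r` ⟹ `(φ − 1)^r w = 0` whenever `p·w = 0` (`φ − 1` is nilpotent on the `p`-group `M[p]`,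
`sub_one_pow_prime_pow_apply_eq_zero_of_smul_eq_zero`, and a nilpotent endomorphism of a `p`-group of order `≤ p^r` vanishes
in `r` steps, tree `pow_apply_eq_zero_of_card_le`). [cite: Washington1997, §13.3 (proof of Prop. 13.23)] -/
theorem sub_one_pow_apply_eq_zero_of_card_torsion_eq [Finite M] (p k r : ℕ) [hp : Fact p.Prime] (φ : Module.End ℤ M)
    (hφ : φ ^ (p ^ k) = 1) (hr : Nat.card {m : M // (p : ℤ) • m = 0} = p ^ r) {w : M} (hw : (p : ℤ) • w = 0) :
    ((φ - 1) ^ r) w = 0 := by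
  set W : Submodule ℤ M := LinearMap.ker ((p : ℤ) • (1 : Module.End ℤ M)) with hWdef
  have hmemW : ∀ m : M, m ∈ W ↔ (p : ℤ) • m = 0 := fun m => by
    rw [hWdef, LinearMap.mem_ker, LinearMap.smul_apply, Module.End.one_apply]
  have hNW : ∀ m ∈ W, (φ - 1) m ∈ W := fun m hm => by
    rw [hmemW] at hm ⊢
    rw [← map_smul, hm, map_zero]
  have hWcard : Nat.card W = p ^ r := by
    rw [← hr]
    exact Nat.card_congr (Equiv.subtypeEquivRight fun m => hmemW m)
  have hnil : ∃ K : ℕ, ((φ - 1).restrict hNW) ^ K = 0 := by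
    refine ⟨p ^ k, LinearMap.ext fun m => ?_⟩
    rw [Module.End.pow_restrict, LinearMap.zero_apply]
    apply Subtype.ext
    rw [LinearMap.coe_restrict_apply, Submodule.coe_zero]
    exact sub_one_pow_prime_pow_apply_eq_zero_of_smul_eq_zero p k φ hφ ((hmemW m).mp m.2)
  have htop : Nat.card (⊤ : Submodule ℤ W) ≤ p ^ r := by
    rw [Nat.card_congr (Submodule.topEquiv (R := ℤ) (M := W)).toEquiv, hWcard]
  have key := pow_apply_eq_zero_of_card_le ⟨r, hWcard⟩ ((φ - 1).restrict hNW) hnil r ⊤ (fun _ _ => Submodule.mem_top) htop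
    ⟨w, (hmemW w).mpr hw⟩ Submodule.mem_top
  rw [Module.End.pow_restrict] at key
  have := congrArg Subtype.val key
  rwa [LinearMap.coe_restrict_apply, Submodule.coe_zero] at this

/-- ★ **`ν_k x = 0`** for `M` finite, `φ^{p^k} = 1`, `#M[p] = p^r`, `2r ≤ p^k − 1`, `k ≥ 2`, and `x` with `p²·x = 0`, `φ(p x) = p x`:
`ν_k x = (φ−1)^{p^k−1} x` and `(φ−1)^{2r} x = 0` (`(φ−1)^r (p x) = 0`, so `(φ−1)^r x ∈ M[p]`, so `(φ−1)^{2r} x = 0`).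
[cite: Washington1997, §13.3 (proofs of Prop. 13.22–13.23)] [cite: Ferrero1980AJM, §3] -/
theorem geom_sum_apply_eq_zero_of_card_torsion_eq [Finite M] (p k r : ℕ) [Fact p.Prime] (hk : 2 ≤ k) (φ : Module.End ℤ M)
    (hφ : φ ^ (p ^ k) = 1) (hr : Nat.card {m : M // (p : ℤ) • m = 0} = p ^ r) (hrk : 2 * r ≤ p ^ k - 1) (x : M)
    (hfix : φ ((p : ℤ) • x) = (p : ℤ) • x) (hx : (p : ℤ) • ((p : ℤ) • x) = 0) :
    (∑ i ∈ range (p ^ k), φ ^ i) x = 0 := by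
  rw [geom_sum_apply_eq_sub_one_pow_apply p k hk φ x hfix hx]
  have h1 : ((φ - 1) ^ r) ((p : ℤ) • x) = 0 := sub_one_pow_apply_eq_zero_of_card_torsion_eq p k r φ hφ hr hx
  have h2 : (p : ℤ) • ((φ - 1) ^ r) x = 0 := by rw [← map_smul]; exact h1
  have h3 : ((φ - 1) ^ r) (((φ - 1) ^ r) x) = 0 := sub_one_pow_apply_eq_zero_of_card_torsion_eq p k r φ hφ hr h2
  obtain ⟨s, hs⟩ : ∃ s, p ^ k - 1 = s + (r + r) := ⟨p ^ k - 1 - 2 * r, by omega⟩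
  rw [hs, pow_add, pow_add, Module.End.mul_apply, Module.End.mul_apply, h3, map_zero]

end FukudaNakayama

/-! ## §2 Ideal classes: `i_{L/F}(N_{L/F} x) = 1` -/

open NumberField Literature.NumberTheory.NumberFields

section Classes

variable (F L : Type) [Field F] [NumberField F] [Field L] [NumberField L] [Algebra F L]

omit [NumberField F] in
/-- `σ ↦ ClassGroup.mulEquiv (intAut σ)` is multiplicative: the action of `σ^i` is the `i`-th power of the action of `σ` in `Aut Cl(L)`
(auxiliary). [folklore] -/
private theorem mulEquiv_intAut_pow (σ : L ≃ₐ[F] L) (i : ℕ) :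
    (ClassGroup.mulEquiv (AmbiguousClass.intAut (σ ^ i)) : MulAut (ClassGroup (𝓞 L))) =
      (ClassGroup.mulEquiv (AmbiguousClass.intAut σ) : MulAut (ClassGroup (𝓞 L))) ^ i := by
  induction i with
  | zero => rw [pow_zero, pow_zero, AmbiguousClass.mulEquiv_intAut_one, MulAut.one_def]
  | succ i ih => rw [pow_succ', pow_succ', AmbiguousClass.mulEquiv_intAut_mul, ih, MulAut.mul_def]

omit [NumberField F] in
/-- `∏_{τ ∈ Gal(L/F)} τ•x = ∏_{i < n} σ^i•x` for a generator `σ` of `Gal(L/F)` of order `n = #Gal(L/F)` (auxiliary). [folklore] -/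
private theorem prod_galois_eq_prod_range [FiniteDimensional F L] (σ : L ≃ₐ[F] L) (hσ : ∀ τ, τ ∈ Subgroup.zpowers σ) {n : ℕ}
    (hn : Nat.card (L ≃ₐ[F] L) = n) (x : ClassGroup (𝓞 L)) :
    ∏ τ : L ≃ₐ[F] L, ClassGroup.mulEquiv (AmbiguousClass.intAut τ) x =
      ∏ i ∈ range n, ((ClassGroup.mulEquiv (AmbiguousClass.intAut σ) : MulAut (ClassGroup (𝓞 L))) ^ i) x := by
  classical
  have htop : Subgroup.zpowers σ = ⊤ := (Subgroup.eq_top_iff' _).mpr hσ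
  have hord : orderOf σ = n := by rw [← Nat.card_zpowers, htop, Subgroup.card_top, hn]
  have hinj : Function.Injective (fun i : Fin n => σ ^ (i : ℕ)) := fun i j hij =>
    Fin.ext (pow_injOn_Iio_orderOf (by rw [Set.mem_Iio, hord]; exact i.2) (by rw [Set.mem_Iio, hord]; exact j.2) hij)
  have hbij : Function.Bijective (fun i : Fin n => σ ^ (i : ℕ)) := by
    rw [Fintype.bijective_iff_injective_and_card]
    exact ⟨hinj, by rw [Fintype.card_fin, ← Nat.card_eq_fintype_card, hn]⟩
  rw [← Fin.prod_univ_eq_prod_range (fun i => ((ClassGroup.mulEquiv (AmbiguousClass.intAut σ) : MulAut (ClassGroup (𝓞 L))) ^ i) x) n,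
    ← Fintype.prod_bijective _ hbij (fun i => ((ClassGroup.mulEquiv (AmbiguousClass.intAut σ) : MulAut (ClassGroup (𝓞 L))) ^ (i : ℕ)) x)
      (fun τ => ClassGroup.mulEquiv (AmbiguousClass.intAut τ) x) (fun i => ?_)]
  rw [← mulEquiv_intAut_pow]

/-- ★ **The norm element of a cyclic `p`-extension kills a `p²`-torsion class with invariant `p`-th power.**  `L/F` Galois with
`Gal(L/F)` cyclic of order `p^k` generated by `σ`, `k ≥ 2`; `#Cl(L)[p] = p^r` with `2r ≤ p^k − 1`; `x ∈ Cl(L)` with `x^{p²} = 1` and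
`σ(x^p) = x^p`.  THEN `i_{L/F}(N_{L/F} x) = ∏_{τ} τ x = 1`. [cite: Washington1997, §13.3 (proofs of Prop. 13.22–13.23)] [cite: Ferrero1980AJM, §3]
[cite: NeukirchANT1999, Ch. III §1 Prop. (1.6) (iv)] -/
theorem classGroupExtend_classGroupNorm_eq_one_of_pow_sq_eq_one [IsGalois F L] (p k r : ℕ) [hp : Fact p.Prime] (hk : 2 ≤ k)
    (σ : L ≃ₐ[F] L) (hσ : ∀ τ, τ ∈ Subgroup.zpowers σ) (hcard : Nat.card (L ≃ₐ[F] L) = p ^ k)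
    (hr : Nat.card {c : ClassGroup (𝓞 L) // c ^ p = 1} = p ^ r) (hrk : 2 * r ≤ p ^ k - 1)
    (x : ClassGroup (𝓞 L)) (hfix : ClassGroup.mulEquiv (AmbiguousClass.intAut σ) (x ^ p) = x ^ p) (hx : x ^ (p ^ 2) = 1) :
    classGroupExtend F L (classGroupNorm F L x) = 1 := by
  classical
  rw [classGroupExtend_classGroupNorm_eq_prod, prod_galois_eq_prod_range F L σ hσ hcard x]
  set g : MulAut (ClassGroup (𝓞 L)) := ClassGroup.mulEquiv (AmbiguousClass.intAut σ) with hgdef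
  set φ : Module.End ℤ (Additive (ClassGroup (𝓞 L))) := (MonoidHom.toAdditive g.toMonoidHom).toIntLinearMap with hφdef
  have hφapp : ∀ y : ClassGroup (𝓞 L), φ (Additive.ofMul y) = Additive.ofMul (g y) := fun y => rfl
  have hφpow : ∀ (i : ℕ) (y : ClassGroup (𝓞 L)), (φ ^ i) (Additive.ofMul y) = Additive.ofMul ((g ^ i) y) := by
    intro i
    induction i with
    | zero => intro y; rw [pow_zero, pow_zero, Module.End.one_apply, MulAut.one_apply]
    | succ i ih => intro y; rw [pow_succ', pow_succ', Module.End.mul_apply, MulAut.mul_apply, ih, hφapp]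
  have hgk : g ^ (p ^ k) = 1 := by
    rw [hgdef, ← mulEquiv_intAut_pow, ← hcard, pow_card_eq_one', AmbiguousClass.mulEquiv_intAut_one, MulAut.one_def]
  have hφk : φ ^ (p ^ k) = 1 := by
    refine LinearMap.ext fun v => ?_
    change (φ ^ (p ^ k)) (Additive.ofMul (Additive.toMul v)) = Additive.ofMul (Additive.toMul v)
    rw [hφpow, hgk, MulAut.one_apply]
  have hsmul : ∀ y : ClassGroup (𝓞 L), (p : ℤ) • Additive.ofMul y = Additive.ofMul (y ^ p) := fun y => by
    rw [← ofMul_zpow, zpow_natCast]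
  have hrank : Nat.card {m : Additive (ClassGroup (𝓞 L)) // (p : ℤ) • m = 0} = p ^ r := by
    rw [← hr]
    refine Nat.card_congr (Equiv.subtypeEquiv Additive.toMul fun m => ?_)
    change (p : ℤ) • Additive.ofMul (Additive.toMul m) = Additive.ofMul 1 ↔ _
    rw [hsmul]
    exact Additive.ofMul.injective.eq_iff
  have hfix' : φ ((p : ℤ) • Additive.ofMul x) = (p : ℤ) • Additive.ofMul x := by
    rw [hsmul, hφapp]
    exact congrArg Additive.ofMul hfix
  have hx' : (p : ℤ) • ((p : ℤ) • Additive.ofMul x) = 0 := by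
    rw [hsmul, hsmul, ← pow_mul, ← sq, hx]
    rfl
  have key := FukudaNakayama.geom_sum_apply_eq_zero_of_card_torsion_eq p k r hk φ hφk hrank hrk (Additive.ofMul x) hfix' hx'
  rw [LinearMap.sum_apply] at key
  simp_rw [hφpow] at key
  rw [← ofMul_prod] at key
  exact Additive.ofMul.injective key

end Classes

end Literature.NumberTheory.IwasawaTheory

end
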